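import Mathlib
import Literature.Computability.Complexity.CNF
import Summits.PneNP.PneNP.Theorems.OverlapGapAlgebraSearchHardWindowLipschitzRung
import Summits.PneNP.PneNP.Theorems.OverlapGapAlgebraSearchHardWindowSmoothMapsFail

/-!
# PneNP / OverlapGapAlgebra — `SearchHardWindow`, the strong Lipschitz rung (4/4): crux language

Support for crux `stmt-PneNP-2460` (`Summit.PneNP.PneNP.Theses.OverlapGapAlgebra.SearchHardWindow`).
* `shwLip_hardnessConjunct_of_lipschitz` — the crux's hardness conjunct (success ratio eventually
  `≤ ε`, every `ε > 0`), verbatim shape, for ANY `f : List Bool → List Bool` (no complexity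
  hypothesis) whose decoded section `Φ ↦ (v ↦ (f ⌜Φ⌝).getD v false)` is `s(n)`-Lipschitz per
  single-literal change, `s(n)² log³ n = o(n)`, modulo smooth-fail at `(k, η, ν, c)`
  (`shwLip_successCount_le_of_smoothFail`, file `…LipschitzRung.lean`).
* `shwLip_lipschitzMapsFail_of_noStableSection`, `shwLip_hardnessConjunct_of_noStableSection` — the
  strong Lipschitz rung and the hardness conjunct for Lipschitz solvers modulo crux `NoStableSection`
  (stmt-PneNP-2462) ALONE, through the accepted `smoothMapsFail_of_noStableSection` (Bresler–Huang
  2021 Thm 2.6 in the authors' general smooth-maps form, escalated seat 1).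
No new definitions; axioms `propext`, `Classical.choice`, `Quot.sound`.
-/

set_option linter.dupNamespace false -- `Summit.PneNP.PneNP.…`: summit = sub-problem (D-0017)

namespace Summit.PneNP.PneNP.Theorems

open Finset Filter Asymptotics
open scoped Classical

/-- **The crux's hardness conjunct for Lipschitz solvers (verbatim shape), modulo smooth-fail at
`(k, η, ν, c)`.** For ANY `f : List Bool → List Bool` (no complexity hypothesis): if, eventually in `n`,
the decoded section `Φ ↦ (v ↦ (f ⌜Φ⌝).getD v false)` of `f` on `F_k(n, ⌊α_k n⌋)` is `s(n)`-Lipschitz per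
single-literal change with `s(n)² log³ n = o(n)`, then the success ratio of `f` is eventually `≤ ε`
for every `ε > 0` — the inner conjunct of `SearchHardWindow` at `(k, α_k)` for this `f`. -/
theorem shwLip_hardnessConjunct_of_lipschitz (k : ℕ) (η ν c : ℝ) (hη : 0 < η) (hν : 0 < ν)
    (hc : 0 < c)
    (hSF : ∀ᶠ n : ℕ in atTop, ∀ m : ℕ, m = ⌊5 * 2 ^ k * Real.log k / k * n⌋₊ →
      ∀ g : (Fin m → Fin k → Fin n × Bool) → (Fin n → Bool),
        (∑ a : Fin m, ∑ b : Fin k,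
          (((Finset.univ : Finset ((Fin m → Fin k → Fin n × Bool) × (Fin n × Bool))).filter
            fun p => η * n < hammingDist (g p.1)
              (g (Function.update p.1 a (Function.update (p.1 a) b p.2)))).card : ℝ))
          ≤ c * n / Real.log (2 * n) * (Fintype.card (Fin m → Fin k → Fin n × Bool) * (2 * n)) →
        c * n / Real.log (2 * n) * Fintype.card (Fin m → Fin k → Fin n × Bool)
          < (k * m : ℕ) * ((Finset.univ.filter fun Φ : Fin m → Fin k → Fin n × Bool =>
              ν * m < ((Finset.univ.filter fun i : Fin m =>
                ∀ j, g Φ (Φ i j).1 ≠ (Φ i j).2).card : ℝ)).card : ℝ))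
    (f : List Bool → List Bool) (s : ℕ → ℝ)
    (hs : (fun n : ℕ => s n ^ 2 * Real.log n ^ 3) =o[atTop] (fun n : ℕ => (n : ℝ)))
    (hf : ∀ᶠ n : ℕ in atTop, ∀ m : ℕ, m = ⌊5 * 2 ^ k * Real.log k / k * n⌋₊ →
      ∃ g : (Fin m → Fin k → Fin n × Bool) → (Fin n → Bool),
        (∀ (Φ : Fin m → Fin k → Fin n × Bool) (v : Fin n), g Φ v =
          (f (Literature.Computability.Complexity.encodingCNF.encode (List.ofFn fun a =>
            List.ofFn fun b => (((Φ a b).1 : ℕ), (Φ a b).2)))).getD v false) ∧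
        ∀ (Φ : Fin m → Fin k → Fin n × Bool) (a : Fin m) (b : Fin k) (ℓ : Fin n × Bool),
          (hammingDist (g Φ) (g (Function.update Φ a (Function.update (Φ a) b ℓ))) : ℝ) ≤ s n) :
    ∀ ε : ℝ, 0 < ε → ∀ᶠ n : ℕ in Filter.atTop, ∀ m : ℕ, m = ⌊5 * 2 ^ k * Real.log k / k * n⌋₊ →
      ((Finset.univ.filter fun Φ : Fin m → Fin k → Fin n × Bool => ∀ i, ∃ j,
          (f (Literature.Computability.Complexity.encodingCNF.encode (List.ofFn fun a =>
            List.ofFn fun b => (((Φ a b).1 : ℕ), (Φ a b).2)))).getD (Φ i j).1 false =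
              (Φ i j).2).card : ℝ) / Fintype.card (Fin m → Fin k → Fin n × Bool) ≤ ε := by
  intro ε hε
  have main := shwLip_successCount_le_of_smoothFail k η ν c hη hν hc hSF s hs ε hε
  filter_upwards [main, hf] with n hmain hfn m hm
  obtain ⟨g, hgf, hg⟩ := hfn m hm
  have h := hmain m hm g hg
  have hset : ((Finset.univ.filter fun Φ : Fin m → Fin k → Fin n × Bool => ∀ i, ∃ j,
      (f (Literature.Computability.Complexity.encodingCNF.encode (List.ofFn fun a =>
        List.ofFn fun b => (((Φ a b).1 : ℕ), (Φ a b).2)))).getD (Φ i j).1 false = (Φ i j).2))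
      = (Finset.univ.filter fun Φ : Fin m → Fin k → Fin n × Bool =>
          ∀ i, ∃ j, g Φ (Φ i j).1 = (Φ i j).2) := by
    refine Finset.filter_congr fun Φ _ => ?_
    simp only [hgf]
  rw [hset]
  by_cases hN : (Fintype.card (Fin m → Fin k → Fin n × Bool) : ℝ) = 0
  · rw [hN, div_zero]; exact hε.le
  · have hNpos : (0 : ℝ) < Fintype.card (Fin m → Fin k → Fin n × Bool) :=
      lt_of_le_of_ne (Nat.cast_nonneg _) (Ne.symm hN)
    rw [div_le_iff₀ hNpos]
    exact h


/-- **Strong Lipschitz rung modulo `NoStableSection` alone.** Assuming the route's probability crux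
`NoStableSection` (stmt-PneNP-2462; Bresler–Huang's ensemble multi-OGP read for all maps): for all
`k ≥ k₀`, every `s` with `s(n)² log³ n = o(n)` and every `ε > 0`, eventually in `n` every search map on
`F_k(n, ⌊α_k n⌋)`, `α_k = 5·2^k log k/k`, that is `s(n)`-Lipschitz in Hamming output per single-literal
change solves at most an `ε`-fraction of the instances. (Composition of
`smoothMapsFail_of_noStableSection` with `shwLip_lipschitzMapsFail_of_smoothMapsFail`.) -/
theorem shwLip_lipschitzMapsFail_of_noStableSection
    (hNo : Summit.PneNP.PneNP.Theses.OverlapGapAlgebra.NoStableSection) :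
    ∃ k₀ : ℕ, ∀ k : ℕ, k₀ ≤ k → ∀ s : ℕ → ℝ,
      (fun n : ℕ => s n ^ 2 * Real.log n ^ 3) =o[atTop] (fun n : ℕ => (n : ℝ)) →
      ∀ ε : ℝ, 0 < ε → ∀ᶠ n : ℕ in atTop, ∀ m : ℕ, m = ⌊5 * 2 ^ k * Real.log k / k * n⌋₊ →
        ∀ g : (Fin m → Fin k → Fin n × Bool) → (Fin n → Bool),
          (∀ (Φ : Fin m → Fin k → Fin n × Bool) (a : Fin m) (b : Fin k) (ℓ : Fin n × Bool),
            (hammingDist (g Φ) (g (Function.update Φ a (Function.update (Φ a) b ℓ))) : ℝ) ≤ s n) →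
          ((Finset.univ.filter fun Φ : Fin m → Fin k → Fin n × Bool =>
              ∀ i, ∃ j, g Φ (Φ i j).1 = (Φ i j).2).card : ℝ)
            ≤ ε * Fintype.card (Fin m → Fin k → Fin n × Bool) :=
  shwLip_lipschitzMapsFail_of_smoothMapsFail (smoothMapsFail_of_noStableSection hNo)

/-- **The crux's hardness conjunct for Lipschitz solvers, modulo `NoStableSection` alone.** For all
`k ≥ k₀` and ANY `f : List Bool → List Bool` (no complexity hypothesis) whose decoded section on
`F_k(n, ⌊α_k n⌋)` is eventually `s(n)`-Lipschitz per single-literal change, `s(n)² log³ n = o(n)`: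
the success ratio of `f` is eventually `≤ ε` for every `ε > 0` — the inner conjunct of
`SearchHardWindow` at `(k, α_k)`, verbatim shape. -/
theorem shwLip_hardnessConjunct_of_noStableSection
    (hNo : Summit.PneNP.PneNP.Theses.OverlapGapAlgebra.NoStableSection) :
    ∃ k₀ : ℕ, ∀ k : ℕ, k₀ ≤ k → ∀ (f : List Bool → List Bool) (s : ℕ → ℝ),
      (fun n : ℕ => s n ^ 2 * Real.log n ^ 3) =o[atTop] (fun n : ℕ => (n : ℝ)) →
      (∀ᶠ n : ℕ in atTop, ∀ m : ℕ, m = ⌊5 * 2 ^ k * Real.log k / k * n⌋₊ →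
        ∃ g : (Fin m → Fin k → Fin n × Bool) → (Fin n → Bool),
          (∀ (Φ : Fin m → Fin k → Fin n × Bool) (v : Fin n), g Φ v =
            (f (Literature.Computability.Complexity.encodingCNF.encode (List.ofFn fun a =>
              List.ofFn fun b => (((Φ a b).1 : ℕ), (Φ a b).2)))).getD v false) ∧
          ∀ (Φ : Fin m → Fin k → Fin n × Bool) (a : Fin m) (b : Fin k) (ℓ : Fin n × Bool),
            (hammingDist (g Φ) (g (Function.update Φ a (Function.update (Φ a) b ℓ))) : ℝ) ≤ s n) →
      ∀ ε : ℝ, 0 < ε → ∀ᶠ n : ℕ in Filter.atTop, ∀ m : ℕ, m = ⌊5 * 2 ^ k * Real.log k / k * n⌋₊ →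
        ((Finset.univ.filter fun Φ : Fin m → Fin k → Fin n × Bool => ∀ i, ∃ j,
            (f (Literature.Computability.Complexity.encodingCNF.encode (List.ofFn fun a =>
              List.ofFn fun b => (((Φ a b).1 : ℕ), (Φ a b).2)))).getD (Φ i j).1 false =
                (Φ i j).2).card : ℝ) / Fintype.card (Fin m → Fin k → Fin n × Bool) ≤ ε := by
  obtain ⟨k₀, h⟩ := smoothMapsFail_of_noStableSection hNo
  refine ⟨k₀, fun k hk f s hs hf => ?_⟩
  obtain ⟨η, hη, ν, hν, c, hc, hSF⟩ := h k hk
  exact shwLip_hardnessConjunct_of_lipschitz k η ν c hη hν hc hSF f s hs hf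

end Summit.PneNP.PneNP.Theorems
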